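import Summits.QuantumFields.YangMills.Theorems.BalabanUVNodesN12MinimiserFamilyOfClassGaugeRow
import Summits.QuantumFields.YangMills.Theorems.BalabanUVNodesN12MultiplierLetterOfClass
import Summits.QuantumFields.YangMills.Theorems.BalabanUVNodesN12SliceDatumCurvatureOfClass
import Literature.MathematicalPhysics.QuantumFieldTheory.Balaban1983to89.B15Prop1MinimiserTowerAxialGauge

/-!
# DAG node N12 [B15] — THE (J0′) PRODUCER OF RECORD WITH ITS ANALYTIC LETTERS ALL DISCHARGED: per (instance, height) ONE gauge-tolerance threshold `δ₀ > 0`; per base field only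
# (E) the (2.12) minimiser · the datum's regularity on `Z` · (δ) the gauge row at `δc ≤ δ₀` · (T1@q₀) — [15] (45), the slice action and datum coordinates, (β), (M), (R2) all INSIDE

[Balaban1989LargeFieldII] = «[LF-II]», p. 357, (1.7)–(1.9) p. 358, (1.12)–(1.13) p. 359; [Balaban1989LargeFieldI] = «[IV]», (1.74) p. 192, Prop. 1 p. 194; [Balaban1985Variational] = «[15]»,
Thm 1 p. 279, Sect. C (44)–(48) p. 285, (81)–(83) p. 290, Sect. G pp. 305–307; [Balaban1984PropagatorsII] = «[B6]», Lemma 2.4 (2.128) p. 245; [Balaban1985Averaging] = «[4]», (122)–(126)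
p. 36; [Balaban1985BackgroundPropagators] = «[B9]», (3.7) p. 391, (3.79)–(3.81) p. 406; [Balaban1988Convergent] = «[III]», (1.3) p. 246, (2.2) p. 255, (2.10)–(2.13) pp. 256–257.

Cell `pub-ymgap`, HUMAN RULINGS D-0062 ∕ D-0149, lane owner `pub-ymgap-dag-n12-c` (g26, strategy s1).  Key K1⁹ `stmt-QuantumFields-27364`, `--kind proof --supports … --as helper`; count-neutral.
NEW leaf; CONSUMED BY NAME, nothing modified: the lane's one-gauge-row producer `…N12MinimiserFamilyOfClassGaugeRow` (g26 V3), dag-n12-w6 g14's multiplier-row producer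
`…N12MultiplierLetterOfClass` ((M) ⟸ class + fibre + forest rows + `a`∕`Φ₀` + (δ) + (R2)), the lane's (R2) inhabitant `…N12SliceDatumCurvatureOfClass` (g26), dag-n12-w6 g11's
`N12HVelocityOfClass.hH_velocity_Bj_of_isMinimizer_class` ([15] (45) in velocity currency per base field from the class).

WHY.  V3 displays per base field the multiplier row (M) with a constant `m` chosen before the base field, and the numerics `64(d−1)δc + m + #constr·C²·δc² < c♭`.  dag-n12-w6's producer
gives (M) with `m := 8(d−1)·δc·B₁·M₂` from the (δ) row and the chart-curvature letter (R2); the lane's `exists_uniform_sliceDatum_curvatureLetter_of_class` gives (R2) with ONE `M₂` per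
height.  So every constant in the numerics is announced per (instance, height) and the numerics hold for all `δc` below a positive threshold `δ₀ := min r (min 1 (c♭ ∕ (2(K+1))))`,
`K := 64(d−1) + 8(d−1)·B₁·M₂ + #constr·C²`.  THIS FILE packages it, defines the slice action `a` and the slice datum coordinates `Φ₀` by their formulas inside, and takes [15] (45) from
dag-n12-w6 g11's class theorem: per base field NO analytic letter and NO definitional row remains.

CONTENTS (namespace `Summit.QuantumFields.YangMills.BalabanUVNodes.N12MinimiserFamilyOfClassThreshold`; three theorems, no `def`, no `instance`, no `sorry`).  §1 ★
`thm1Row_gaugeAct_of_residual` ((T1@q₀) passes to `U₀^σ` for a residual `σ`); §3 ★★★ `…_threshold_residual` (the gauge row asked of `U₀^σ`, `σ` residual — the (σ)_N producer's output shape); §2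
★★★ `hMin_atRecord_of_node00Letters_thm1AtBase_central_ofClass_threshold` — instance-level: the capstone's record data + one forest with (F1), (F2), (TREE), (F3); per height: the radius
letter `hsbU` at a POSITIVE `ρ″`, the floors `12(d−1)L·εreg ≤ ρ″`, `6(d−1)Lᵏ·δ ≤ ρ″`, dag-n12-w6's right-inverse letter `hHB` at `(εH, B)` with `εreg ≤ εH`, `0 ≤ B` (all inhabited by
`N12HsurjOfClass.exists_hsurjLetters`); ANNOUNCED `∃ δ₀ > 0`; then for every `0 ≤ δc ≤ δ₀` and per base field (E) · datum regularity · (δ) at `δc` · (T1@q₀) ⇒ the (J0′) conclusion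
VERBATIM.

HONEST FRAMING ∕ LOCATED.  Composition by name + one line of real arithmetic; (E) and (T1@q₀) are [15] Thm 1's rows (existence in the OPEN class = interiority; uniqueness modulo the
central residual gauge — NODE 00 ∕ b11 currency); (δ) is a GAUGE letter (bondwise near-flatness after a residual normalisation — the direct road's (N) producers; LOCATED-GEOM v3 for the
shape coverage: vacuous-by-shape on ring-like `Ω₁(Z)` with large datum holonomy); `δ₀` and every absorbed constant are EXISTENCE constants per (instance, height) (U4 grade; k-uniformity
NOT claimed); nothing of Bałaban's estimates asserted; count-neutral helper; N12 NOT discharged; K1⁹ NOT closed; counts unmoved; one finite 𝕋⁴ programme at fixed ε — R4 closes the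
conditional finite-𝕋⁴ rung `BalabanLadder.UV` only; NOT continuum ∕ OS ∕ mass gap ∕ Clay.
-/

noncomputable section

open scoped BigOperators Matrix.Norms.L2Operator Topology

namespace Summit.QuantumFields.YangMills.BalabanUVNodes.N12MinimiserFamilyOfClassThreshold

open Set Metric Filter
open Literature.MathematicalPhysics.QuantumFieldTheory.Balaban1983to89
open Literature.MathematicalPhysics.QuantumFieldTheory.Balaban1983to89.Node00 (SU coeField coeField_apply SmallBelow ConstrSet constrCard constrEnum dIterL)
open T4Continuum B15DeterminingSets GaugeField
open B14.Eq213MaximalDomains (side)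
open B14.Eq213DetSet (Bj Bj_of_gt Bj_zero maxDomT)
open B15Prop1Carrier (plaqsInside)
open B15AveragingHolomorphic (iterMh)
open B15ComplexifiedDatumFamily (conjVec)
open B15SU2ChartHolomorphic (genE expMulC logCoordC)
open B15Prop1AnalyticExtClause (cplxVec norm_cplxVec_apply)
open B15Prop1ChartCalculusSU2 (E3)
open B15Prop1ChartSU2 (su2Chart)
open B15ShellGauge193 (shellGauge)
open B15Extension193 (extend)
open B16Sect1Backgrounds (toMS expMul)
open ExpMeanLog (expMeanLogSU)
open BlockAveraging (blockAvg)
open T4CubeChartGnomonic (SU2)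
open Literature.MathematicalPhysics.QuantumFieldTheory.BalabanImbrieJaffe1984to88.BIJ85Eq453GaugeField (qsstarGIter0)
open Summit.QuantumFields.YangMills.BalabanUVNodes.N12MinimiserFamilyOfClassGaugeRow (hMin_atRecord_of_node00Letters_thm1AtBase_central_ofClass_gaugeRow)
open Summit.QuantumFields.YangMills.BalabanUVNodes.N12MultiplierLetterOfClass (multiplierLetter_Bj_of_isMinimizer_class_of_curvatureLetter)
open Summit.QuantumFields.YangMills.BalabanUVNodes.N12HVelocityOfClass (hH_velocity_Bj_of_isMinimizer_class)
open B15Prop1MinimiserTowerAxialGauge (isMinimizer_gaugeAct_of_residual)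
open B15Eq177ValueInvarianceCoDiv (gaugeAct_mem_regMSCoPOfRecord)
open B16Sect1Backgrounds (mulG gaugeAct_gaugeAct)
open B14Eq16FaddeevPopov (wilsonAction4_gaugeAct')
open Summit.QuantumFields.YangMills.BalabanUVNodes.N12SliceDatumCurvatureOfClass (exists_uniform_sliceDatum_curvatureLetter_of_class)
open B5Eq118OneStroke (iterBlockOf)
open B14.Eq216Concrete (feeds)
open B15Eq112TorusCover (lift)
open T4AxialGaugeSmallField (boxPlaqs)
open T4AdjointCovarianceUnitary (lieSU)
open Node00 (msChart avOfRecord regMSCoPOfRecord)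
open scoped Matrix.Norms.L2Operator

variable {F : T4Family} {k : ℕ}

/-! ## §1  The Theorem-1 row is invariant under a residual gauge of the minimiser -/

/-- ★ **(T1@q₀) FOR `U₀^σ` FROM (T1@q₀) FOR `U₀`, `σ` RESIDUAL** (generic lattice, class, determining set, datum): if every constrained `U ∈ reg′` with `A(U) ≤ A(U₀)` is carried to `U₀`
by a gauge whose scale-`j` images agree at the two ends of every constrained bond and are central there, then the same holds with `U₀` replaced by `U₀^σ` for every `σ` whose scale-`j`
images are `1` at those ends (`A(U₀^σ) = A(U₀)`; compose with `σ`: `(σu)` has the images of `u` at the constrained ends).  [15] (181): the residual group of the constraints acts on the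
minimal orbit. [cite: Balaban1985Variational, (3)–(4) p.278, (181) p.307; Balaban1988Convergent, (2.12) p.256] -/
theorem thm1Row_gaugeAct_of_residual {P : Params} (av : ∀ j, Averaging P j SU2) (reg' : Set (GaugeField P 0 SU2)) (𝔹 : DetSet P) (kc : ℕ)
    (V : MSField P SU2) {σ : GaugeTransf P 0 SU2}
    (hσ : ∀ j, j ≤ kc → ∀ b ∈ bondsOf (𝔹 j), toMS σ j b.src = 1 ∧ toMS σ j b.tgt = 1) {U₀ : GaugeField P 0 SU2}
    (hT1 : ∀ U ∈ reg', AgreeOn 𝔹 (avgFamily av U) V → wilsonAction4 U ≤ wilsonAction4 U₀ →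
      ∃ u : GaugeTransf P 0 SU2, (∀ j, j ≤ kc → ∀ b ∈ bondsOf (𝔹 j), toMS u j b.src = toMS u j b.tgt ∧ ∀ g : SU2, toMS u j b.src * g = g * toMS u j b.src) ∧ gaugeAct u U = U₀) :
    ∀ U ∈ reg', AgreeOn 𝔹 (avgFamily av U) V → wilsonAction4 U ≤ wilsonAction4 (gaugeAct σ U₀) →
      ∃ u : GaugeTransf P 0 SU2, (∀ j, j ≤ kc → ∀ b ∈ bondsOf (𝔹 j), toMS u j b.src = toMS u j b.tgt ∧ ∀ g : SU2, toMS u j b.src * g = g * toMS u j b.src) ∧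
        gaugeAct u U = gaugeAct σ U₀ := by
  intro U hU hUV hA
  rw [wilsonAction4_gaugeAct'] at hA
  obtain ⟨u, hu, huU⟩ := hT1 U hU hUV hA
  refine ⟨mulG σ u, fun j hj b hb => ?_, by rw [← gaugeAct_gaugeAct, huU]⟩
  obtain ⟨hst, hcen⟩ := hu j hj b hb
  obtain ⟨hs1, ht1⟩ := hσ j hj b hb
  have hs : toMS (mulG σ u) j b.src = toMS u j b.src := by
    show σ (embIter j b.src) * u (embIter j b.src) = u (embIter j b.src)
    rw [show σ (embIter j b.src) = 1 from hs1, one_mul]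
  have ht : toMS (mulG σ u) j b.tgt = toMS u j b.tgt := by
    show σ (embIter j b.tgt) * u (embIter j b.tgt) = u (embIter j b.tgt)
    rw [show σ (embIter j b.tgt) = 1 from ht1, one_mul]
  rw [hs, ht]
  exact ⟨hst, hcen⟩

/-! ## §2  The producer with one threshold -/

/-- ★★★ **THE (J0′) PRODUCER AT N12's RECORD WITH NO ANALYTIC LETTER PER BASE FIELD.**  Instance-level: the capstone's record data + ONE forest with its axial slice.  Per height: the
radius letter at a positive `ρ″`, the floors, dag-n12-w6's right-inverse letter `hHB`.  ANNOUNCED: `∃ δ₀ > 0`.  THEN for every gauge tolerance `0 ≤ δc ≤ δ₀` and per base field `V_k ∈ K`: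
(E) the minimiser `U₀`, the datum's regularity on `Z`, (δ) `U₀` `δc`-flat on the plaquettes meeting a bond sourced in `Ω₁(Z)`, (T1@q₀) — NOTHING ELSE (the slice action `a` and the
slice datum coordinates `Φ₀` are DEFINED inside by their formulas; [15] (45) in velocity currency is dag-n12-w6's `N12HVelocityOfClass.hH_velocity_Bj_of_isMinimizer_class`) — the conclusion `∃ R > 0, ∀ V_k ∈ K, ∃ Ũ holomorphic bounded on the polydisc with (2.12)-minimiser real points`.  Proof: V3 (`…OfClassGaugeRow`) at
`m := 8(d−1)·δc·B₁·M₂`, its (M) row supplied by dag-n12-w6's `multiplierLetter_Bj_of_isMinimizer_class_of_curvatureLetter` fed the (R2) letter of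
`N12SliceDatumCurvatureOfClass.exists_uniform_sliceDatum_curvatureLetter_of_class` (one `M₂` per height), the forest roots from (F2), the path-length bound from finiteness; the threshold
`δ₀ := min r (min 1 (c♭ ∕ (2(K+1))))`, `K := 64(d−1) + 8(d−1)·B₁·M₂ + #constr·C²`.
[cite: Balaban1989LargeFieldII, p.357, (1.7)–(1.9) p.358, (1.12)–(1.13) p.359; Balaban1989LargeFieldI, (1.74) p.192, Prop. 1 p.194; Balaban1985Variational, Thm 1 p.279, Sect. C (44)–(48) p.285, (81)–(83) p.290, Sect. G pp.305–307; Balaban1984PropagatorsII, Lemma 2.4 (2.128) p.245; Balaban1985Averaging, (122)–(126) p.36; Balaban1985BackgroundPropagators, (3.7) p.391, (3.79)–(3.81) p.406; Balaban1988Convergent, (1.3) p.246, (2.2) p.255, (2.10)–(2.13) pp.256–257] -/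
theorem hMin_atRecord_of_node00Letters_thm1AtBase_central_ofClass_threshold (ν : Node00.Stage7Numerics) (Kt : ℕ) (hd : 2 ≤ (F.P Kt).d) (Z : Set (Site (F.P Kt) 0))
    (Λ : Set (Site (F.P Kt) k)) (lo hi : Fin (F.P Kt).d → ℤ) (𝔹 : DetSet (F.P Kt)) (h𝔹Z : 𝔹 = Bj ν.M₁ Z k) (hkK : k + 1 ≤ (F.P Kt).m + (F.P Kt).K)
    (hM4 : 4 * (F.P Kt).L ≤ ν.M₁) (hdiv : side (F.P Kt).L ν.M₁ k ∣ (F.P Kt).sitesPerDir 0) (hZblk : B14.Eq22Determines.IsBlockUnion k Z) (hε : 0 ≤ ν.εreg)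
    {ρ'' : ℝ} (hsbU : ∀ W : GaugeField (F.P Kt) 0 SU2, ‖coeField W - 1‖ ≤ ρ'' → SmallBelow (Node00.avOfRecord F 2 Kt) k W)
    (hρ : 0 < ρ'') (hερ : 12 * ((((F.P Kt).d - 1 : ℕ)) : ℝ) * (F.P Kt).L * ν.εreg ≤ ρ'') {δ : ℝ} (hδ : 0 < δ) (hδρ : 6 * ((((F.P Kt).d - 1 : ℕ)) : ℝ) * (F.P Kt).L ^ k * δ ≤ ρ'')
    (ext : GaugeField (F.P Kt) k SU2 → GaugeField (F.P Kt) k SU2) (hext : ∀ W, ext W = extend Λ (shellGauge W lo hi) W)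
    {K : Set (GaugeField (F.P Kt) k SU2)} (hK : IsCompact K) {𝓐₀ : ℝ} (h𝓐₀ : 1 < 𝓐₀)
    (reg' : Set (GaugeField (F.P Kt) 0 SU2)) (hreg' : IsClosed reg') (hcl : closure (Node00.regMSCoPOfRecord F 2 ν Kt k (maxDomT ν.M₁ Z)) ⊆ reg')
    (hDreg' : ContinuousOn (fun (U : GaugeField (F.P Kt) 0 SU2) (i : Fin (constrCard 𝔹 k)) =>
      ((avgFamily (Node00.avOfRecord F 2 Kt) U ((constrEnum 𝔹 k).symm i).1 ((constrEnum 𝔹 k).symm i).2.1 : SU2) : Matrix (Fin 2) (Fin 2) ℂ)) reg')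
    (hk0 : 0 < k)
    -- ONCE per height: the right-inverse letter of the real chart (dag-n12-w6's `hHB`, inhabited by `N12HsurjOfClass.exists_hsurjLetters`)
    {εH B : ℝ}
    (hHB : ∀ (Wd : MSField (F.P Kt) SU2) (U₀ : GaugeField (F.P Kt) 0 SU2),
      AgreeOn (Bj ν.M₁ Z k) (avgFamily (avOfRecord F 2 Kt) U₀) Wd →
      (∀ i' : Fin (constrCard (Bj ν.M₁ Z k) k), ∃ U' : GaugeField (F.P Kt) 0 SU2,
        (∀ b ∈ feeds (((constrEnum (Bj ν.M₁ Z k) k).symm i').1 : ℕ) ((constrEnum (Bj ν.M₁ Z k) k).symm i').2.1, U' b = U₀ b) ∧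
          SmallBelow (avOfRecord F 2 Kt) k U') →
      (∀ (j : ℕ), 1 ≤ j → j ≤ k → ∀ y : Site (F.P Kt) j, embIter j y ∈ maxDomT ν.M₁ Z j → ∃ U' : GaugeField (F.P Kt) 0 SU2,
        (∀ c : PBond (F.P Kt) j, (c.src = y ∨ c.tgt = y) → ∀ b₀ : PBond (F.P Kt) 0,
          (iterBlockOf j b₀.src = c.src ∨ iterBlockOf j b₀.src = c.tgt) → (iterBlockOf j b₀.tgt = c.src ∨ iterBlockOf j b₀.tgt = c.tgt) → U' b₀ = U₀ b₀) ∧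
        SmallBelow (avOfRecord F 2 Kt) k U') →
      (∀ (j : ℕ), 1 ≤ j → j ≤ k → ∀ y : Site (F.P Kt) j, embIter j y ∈ maxDomT ν.M₁ Z j →
        PlaqSmallOn (boxPlaqs (fun κ => lift (F.P Kt) (embIter j y) κ - ((((F.P Kt).L ^ j : ℕ) : ℤ) + ((((F.P Kt).L ^ j - 1) / 2 : ℕ) : ℤ)))
          (fun κ => lift (F.P Kt) (embIter j y) κ + ((((F.P Kt).L ^ j : ℕ) : ℤ) + ((((F.P Kt).L ^ j - 1) / 2 : ℕ) : ℤ))) : Set (Plaq (F.P Kt) 0)) εH U₀) →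
      ∃ H : (Fin (constrCard (Bj ν.M₁ Z k) k) → lieSU (Fin 2)) → PBond (F.P Kt) 0 → lieSU (Fin 2),
        (∀ v, fderiv ℝ (msChart F 2 Kt k (Bj ν.M₁ Z k) Wd U₀) 0 (H v) = v) ∧ ∀ v, Real.sqrt (∑ b, ‖H v b‖ ^ 2) ≤ B * ‖v‖)
    (hεH : ν.εreg ≤ εH) (hB0 : 0 ≤ B)
    -- ONE forest and its axial slice per instance (dag-n12-w3's `N12ForestSlice.exists_forest_slice_Bj`): (F1), (F2), (TREE), (F3)
    (path : Site (F.P Kt) 0 → List (LStep (F.P Kt) 0)) (S : Submodule ℂ (VecField (F.P Kt) 0 (EuclideanSpace ℂ (Fin 3))))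
    (hF1 : ∀ x, ∀ s ∈ path x, ∃ x' x'' : Site (F.P Kt) 0, path x'' = path x' ++ [s] ∧
        (s.fwd = true → s.bond.src = x' ∧ s.bond.tgt = x'') ∧ (s.fwd = false → s.bond.src = x'' ∧ s.bond.tgt = x'))
    (hF2 : ∀ j, j ≤ k → ∀ c ∈ bondsOf (𝔹 j), path (embIter j c.src) = [] ∧ path (embIter j c.tgt) = [])
    (hTREE : ∀ x : Site (F.P Kt) 0, x ∉ {z : Site (F.P Kt) 0 | ∃ j, j ≤ k ∧ ∃ c ∈ bondsOf (𝔹 j), (z = embIter j c.src ∨ z = embIter j c.tgt)} →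
      ∃ (x' : Site (F.P Kt) 0) (s : LStep (F.P Kt) 0), path x = path x' ++ [s] ∧
        (s.fwd = true → s.bond.src = x' ∧ s.bond.tgt = x) ∧ (s.fwd = false → s.bond.src = x ∧ s.bond.tgt = x'))
    (hF3 : ∀ X : VecField (F.P Kt) 0 (EuclideanSpace ℂ (Fin 3)), X ∈ S ↔ ∀ x, ∀ s ∈ path x, X s.bond = 0) :
    -- THE GAUGE-TOLERANCE THRESHOLD, announced before the base fields (it absorbs the flat coercivity `c♭` of (P♭Q), the (L) constant and radius, the preimage letter `B₁` and the chart curvature `M₂`)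
    ∃ δ₀ : ℝ, 0 < δ₀ ∧
    ∀ {δc : ℝ}, 0 ≤ δc → δc ≤ δ₀ →
    (∀ Vk ∈ K, ∃ U₀ : GaugeField (F.P Kt) 0 SU2,
      IsMinimizer (Node00.avOfRecord F 2 Kt) (Node00.regMSCoPOfRecord F 2 ν Kt k (maxDomT ν.M₁ Z)) 𝔹
        (avgFamily (Node00.avOfRecord F 2 Kt) (qsstarGIter0 k (ext Vk))) U₀ ∧
      PlaqSmallOn (plaqsInside (pts k Z)) δ (ext Vk) ∧
      -- (δ) DISPLAYED — THE ONE GAUGE letter (the direct road's (N)-package clause): `U₀` bondwise `δc`-flat on the plaquettes meeting a bond sourced in `Ω₁(Z)`; the tower-flatness row (δ_T) and the multiplier row (M) of p717767 FOLLOW (`B15Prop1TowerFlatOfNearFlat`; dag-n12-w6's `…N12MultiplierLetterOfClass` + the lane's `…N12SliceDatumCurvatureOfClass`)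
      (∀ q : Plaq (F.P Kt) 0, ((⟨q.src, q.μ⟩ : PBond (F.P Kt) 0) ∈ {b : PBond (F.P Kt) 0 | b.src ∈ maxDomT ν.M₁ Z 1} ∨
          (⟨q.src.shift q.μ, q.ν⟩ : PBond (F.P Kt) 0) ∈ {b : PBond (F.P Kt) 0 | b.src ∈ maxDomT ν.M₁ Z 1} ∨
          (⟨q.src.shift q.ν, q.μ⟩ : PBond (F.P Kt) 0) ∈ {b : PBond (F.P Kt) 0 | b.src ∈ maxDomT ν.M₁ Z 1} ∨
          (⟨q.src, q.ν⟩ : PBond (F.P Kt) 0) ∈ {b : PBond (F.P Kt) 0 | b.src ∈ maxDomT ν.M₁ Z 1}) →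
        ‖((U₀ ⟨q.src, q.μ⟩ : SU2) : Matrix (Fin 2) (Fin 2) ℂ) - 1‖ ≤ δc ∧ ‖((U₀ ⟨q.src.shift q.μ, q.ν⟩ : SU2) : Matrix (Fin 2) (Fin 2) ℂ) - 1‖ ≤ δc ∧
          ‖((U₀ ⟨q.src.shift q.ν, q.μ⟩ : SU2) : Matrix (Fin 2) (Fin 2) ℂ) - 1‖ ≤ δc ∧ ‖((U₀ ⟨q.src, q.ν⟩ : SU2) : Matrix (Fin 2) (Fin 2) ℂ) - 1‖ ≤ δc) ∧
      -- (T1@q₀) — the capstone's row verbatim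
      (∀ U ∈ reg', AgreeOn 𝔹 (avgFamily (Node00.avOfRecord F 2 Kt) U) (avgFamily (Node00.avOfRecord F 2 Kt) (qsstarGIter0 k (ext Vk))) →
        wilsonAction4 U ≤ wilsonAction4 U₀ →
          ∃ u : GaugeTransf (F.P Kt) 0 SU2, (∀ j, j ≤ k → ∀ b ∈ bondsOf (𝔹 j), toMS u j b.src = toMS u j b.tgt ∧ ∀ g : SU2, toMS u j b.src * g = g * toMS u j b.src) ∧ gaugeAct u U = U₀)) →
    ∃ R : ℝ, 0 < R ∧ ∀ Vk ∈ K,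
      ∃ Ũ : VecField (F.P Kt) k (EuclideanSpace ℂ (Fin 3)) × VecField (F.P Kt) k (EuclideanSpace ℂ (Fin 3)) → PBond (F.P Kt) 0 → Matrix (Fin 2) (Fin 2) ℂ,
        (∀ b i j, DifferentiableOn ℂ (fun z => Ũ z b i j) (ball 0 R)) ∧
        (∀ z ∈ ball (0 : VecField (F.P Kt) k (EuclideanSpace ℂ (Fin 3)) × VecField (F.P Kt) k (EuclideanSpace ℂ (Fin 3))) R, ∀ b i j, ‖Ũ z b i j‖ ≤ 𝓐₀) ∧
        ∀ p B' : VecField (F.P Kt) k E3, ‖p‖ < R → ‖B'‖ < R → ∃ U' : GaugeField (F.P Kt) 0 SU2,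
          (∀ b, Ũ (cplxVec p, cplxVec B') b = ((U' b : SU2) : Matrix (Fin 2) (Fin 2) ℂ)) ∧
            IsMinimizer (Node00.avOfRecord F 2 Kt) (Node00.regMSCoPOfRecord F 2 ν Kt k (maxDomT ν.M₁ Z)) 𝔹
              (avgFamily (Node00.avOfRecord F 2 Kt) (qsstarGIter0 k (expMul su2Chart B' (ext (expMul su2Chart p Vk))))) U' := by
  subst h𝔹Z
  have hk : k ≤ (F.P Kt).m + (F.P Kt).K := Nat.le_of_succ_le hkK
  have hM : 1 ≤ ν.M₁ := le_trans (le_trans (F.P Kt).L_pos (by omega)) hM4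
  have hd1 : (0 : ℝ) ≤ ((((F.P Kt).d - 1 : ℕ)) : ℝ) := Nat.cast_nonneg _
  have hερ6 : 6 * ((((F.P Kt).d - 1 : ℕ)) : ℝ) * (F.P Kt).L * ν.εreg ≤ ρ'' := by
    have h : 0 ≤ ((((F.P Kt).d - 1 : ℕ)) : ℝ) * (F.P Kt).L * ν.εreg := by positivity
    linarith
  -- V3's constants, the chart-curvature constant of the height, the forest path-length bound
  obtain ⟨cflat, C, r, hcflat, hC, hr, hV3⟩ := hMin_atRecord_of_node00Letters_thm1AtBase_central_ofClass_gaugeRow ν Kt hd Z Λ lo hi (Bj ν.M₁ Z k) rfl hkK hM4 hdiv hZblk hε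
    hsbU hερ6 hδ hδρ ext hext hK h𝓐₀ reg' hreg' hcl hDreg' hk0 path S hF1 hF2 hTREE hF3
  obtain ⟨M₂, hM₂, hR2⟩ := exists_uniform_sliceDatum_curvatureLetter_of_class ν Kt hd Z hkK hM4 hdiv hε hρ hsbU hερ
  obtain ⟨Lp, hlen⟩ : ∃ Lp : ℕ, ∀ x, (path x).length ≤ Lp :=
    ⟨Finset.univ.sup fun x => (path x).length, fun x => Finset.le_sup (f := fun x => (path x).length) (Finset.mem_univ x)⟩
  have hroot : ∀ r ∈ {z : Site (F.P Kt) 0 | ∃ j, j ≤ k ∧ ∃ c ∈ bondsOf ((Bj ν.M₁ Z k : DetSet (F.P Kt)) j), (z = embIter j c.src ∨ z = embIter j c.tgt)}, path r = [] := by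
    rintro r ⟨j, hj, c, hc, hrc⟩
    rcases hrc with rfl | rfl
    exacts [(hF2 j hj c hc).1, (hF2 j hj c hc).2]
  -- the threshold
  obtain ⟨B₁, hB₁⟩ : ∃ B₁ : ℝ, B₁ = Real.sqrt 2 * ((1 + 2 * (Fintype.card (PBond (F.P Kt) 0)) * Lp) * Real.sqrt (Fintype.card (PBond (F.P Kt) 0)) * B) := ⟨_, rfl⟩
  have hB₁0 : 0 ≤ B₁ := by rw [hB₁]; positivity
  obtain ⟨Kc, hKc⟩ : ∃ Kc : ℝ, Kc = 64 * (((F.P Kt).d : ℝ) - 1) + 8 * (((F.P Kt).d : ℝ) - 1) * B₁ * M₂ + (constrCard (Bj ν.M₁ Z k) k : ℝ) * C ^ 2 := ⟨_, rfl⟩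
  have hdR : (0 : ℝ) ≤ ((F.P Kt).d : ℝ) - 1 := by
    have : (1 : ℝ) ≤ ((F.P Kt).d : ℝ) := by exact_mod_cast (le_trans (by norm_num) hd)
    linarith
  have hKc0 : 0 ≤ Kc := by rw [hKc]; positivity
  refine ⟨min r (min 1 (cflat / (2 * (Kc + 1)))), lt_min hr (lt_min one_pos (by positivity)), fun {δc} hδc0 hδcδ hbase => ?_⟩
  have hδcr : δc ≤ r := hδcδ.trans (min_le_left _ _)
  have hδc1 : δc ≤ 1 := hδcδ.trans ((min_le_right _ _).trans (min_le_left _ _))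
  have hδcK : δc ≤ cflat / (2 * (Kc + 1)) := hδcδ.trans ((min_le_right _ _).trans (min_le_right _ _))
  -- the numerics of V3 at `m := 8(d−1)·δc·B₁·M₂`
  have hnum : 64 * (((F.P Kt).d : ℝ) - 1) * δc + 8 * (((F.P Kt).d : ℝ) - 1) * δc * B₁ * M₂ + (constrCard (Bj ν.M₁ Z k) k : ℝ) * C ^ 2 * δc ^ 2 < cflat := by
    have hsq : δc ^ 2 ≤ δc := by nlinarith
    have h3 : (constrCard (Bj ν.M₁ Z k) k : ℝ) * C ^ 2 * δc ^ 2 ≤ (constrCard (Bj ν.M₁ Z k) k : ℝ) * C ^ 2 * δc :=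
      mul_le_mul_of_nonneg_left hsq (by positivity)
    have h1 : 64 * (((F.P Kt).d : ℝ) - 1) * δc + 8 * (((F.P Kt).d : ℝ) - 1) * δc * B₁ * M₂ + (constrCard (Bj ν.M₁ Z k) k : ℝ) * C ^ 2 * δc ^ 2 ≤ Kc * δc := by
      have he : Kc * δc = 64 * (((F.P Kt).d : ℝ) - 1) * δc + 8 * (((F.P Kt).d : ℝ) - 1) * δc * B₁ * M₂ + (constrCard (Bj ν.M₁ Z k) k : ℝ) * C ^ 2 * δc := by
        rw [hKc]; ring
      rw [he]
      linarith
    have h2 : Kc * δc ≤ Kc * (cflat / (2 * (Kc + 1))) := mul_le_mul_of_nonneg_left hδcK hKc0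
    have h4 : Kc * (cflat / (2 * (Kc + 1))) < cflat := by
      have hpos : 0 < 2 * (Kc + 1) := by positivity
      rw [mul_div_assoc', div_lt_iff₀ hpos]
      nlinarith
    linarith
  refine hV3 (δc := δc) (m := 8 * (((F.P Kt).d : ℝ) - 1) * δc * B₁ * M₂) hδc0 hδcr hnum fun Vk hVk => ?_
  obtain ⟨U₀, hmin, hreg, hNF, hT1⟩ := hbase Vk hVk
  -- the slice action and the slice datum coordinates, DEFINED by their formulas
  let a : S → ℂ := fun X => ∑ p : Plaq (F.P Kt) 0, (1 - (expMulC (X : VecField (F.P Kt) 0 (EuclideanSpace ℂ (Fin 3))) (coeField U₀) ⟨p.src, p.μ⟩ *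
        expMulC (X : VecField (F.P Kt) 0 (EuclideanSpace ℂ (Fin 3))) (coeField U₀) ⟨p.src.shift p.μ, p.ν⟩ *
        Matrix.adjugate (expMulC (X : VecField (F.P Kt) 0 (EuclideanSpace ℂ (Fin 3))) (coeField U₀) ⟨p.src.shift p.ν, p.μ⟩) *
        Matrix.adjugate (expMulC (X : VecField (F.P Kt) 0 (EuclideanSpace ℂ (Fin 3))) (coeField U₀) ⟨p.src, p.ν⟩)).trace / 2)
  let Φ₀ : S → Fin (constrCard (Bj ν.M₁ Z k) k) → EuclideanSpace ℂ (Fin 3) := fun X i =>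
    logCoordC (star ((avgFamily (Node00.avOfRecord F 2 Kt) (qsstarGIter0 k (ext Vk))
        ((constrEnum (Bj ν.M₁ Z k) k).symm i).1 ((constrEnum (Bj ν.M₁ Z k) k).symm i).2.1 : SU2) : Matrix (Fin 2) (Fin 2) ℂ) *
        iterMh ((constrEnum (Bj ν.M₁ Z k) k).symm i).1 (expMulC (X : VecField (F.P Kt) 0 (EuclideanSpace ℂ (Fin 3))) (coeField U₀)) ((constrEnum (Bj ν.M₁ Z k) k).symm i).2.1)
  have ha : ∀ X : S, a X = ∑ p : Plaq (F.P Kt) 0, (1 - (expMulC (X : VecField (F.P Kt) 0 (EuclideanSpace ℂ (Fin 3))) (coeField U₀) ⟨p.src, p.μ⟩ *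
        expMulC (X : VecField (F.P Kt) 0 (EuclideanSpace ℂ (Fin 3))) (coeField U₀) ⟨p.src.shift p.μ, p.ν⟩ *
        Matrix.adjugate (expMulC (X : VecField (F.P Kt) 0 (EuclideanSpace ℂ (Fin 3))) (coeField U₀) ⟨p.src.shift p.ν, p.μ⟩) *
        Matrix.adjugate (expMulC (X : VecField (F.P Kt) 0 (EuclideanSpace ℂ (Fin 3))) (coeField U₀) ⟨p.src, p.ν⟩)).trace / 2) := fun X => rfl
  have hΦ₀ : ∀ (X : S) i, Φ₀ X i = logCoordC (star ((avgFamily (Node00.avOfRecord F 2 Kt) (qsstarGIter0 k (ext Vk))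
        ((constrEnum (Bj ν.M₁ Z k) k).symm i).1 ((constrEnum (Bj ν.M₁ Z k) k).symm i).2.1 : SU2) : Matrix (Fin 2) (Fin 2) ℂ) *
        iterMh ((constrEnum (Bj ν.M₁ Z k) k).symm i).1 (expMulC (X : VecField (F.P Kt) 0 (EuclideanSpace ℂ (Fin 3))) (coeField U₀)) ((constrEnum (Bj ν.M₁ Z k) k).symm i).2.1) :=
    fun X i => rfl
  -- [15] (45) in velocity currency, per base field from the class (dag-n12-w6 g11)
  have hH := hH_velocity_Bj_of_isMinimizer_class ν Kt Z hkK hM4 hdiv hε hsbU hερ6 hHB hεH hmin hmin.2.1 S hroot hF1 hF3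
  -- (M) per base field: dag-n12-w6's producer fed the height's (R2)
  have hcurv := hR2 U₀ hmin.1 _ hmin.2.1 S Φ₀ hΦ₀
  have hMul := multiplierLetter_Bj_of_isMinimizer_class_of_curvatureLetter ν Kt Z hk0 hkK hM4 hdiv hε hsbU hερ6 hHB hεH hB0 hmin hmin.2.1 S hroot hF1 hF3 hlen ha hΦ₀ hδc0 hNF hcurv
  refine ⟨U₀, a, Φ₀, hmin, hreg, ha, hΦ₀, hH, hNF, ?_, hT1⟩
  intro ℓ₀ hℓ₀ p hp hker
  have h := hMul ℓ₀ hℓ₀ p hp hker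
  have hm : 8 * (((F.P Kt).d : ℝ) - 1) * δc * (Real.sqrt 2 * ((1 + 2 * (Fintype.card (PBond (F.P Kt) 0)) * Lp) * Real.sqrt (Fintype.card (PBond (F.P Kt) 0)) * B)) * M₂ =
      8 * (((F.P Kt).d : ℝ) - 1) * δc * B₁ * M₂ := by rw [hB₁]
  rw [hm] at h
  exact h


/-! ## §3  The same with the gauge row asked of a RESIDUAL re-gauging of the minimiser (the (σ)_N producer's output shape) -/

/-- ★★★ **THE (J0′) PRODUCER WITH THE GAUGE ROW IN RESIDUAL-GAUGE FORM.**  As §2, but per base field the consumer supplies the minimiser `U₀`, the datum's regularity, a RESIDUAL gauge `σ`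
(scale-`j` images `1` at both ends of every constrained bond of `𝐁_k(Z)`), the (δ) row for `U₀^σ`, and (T1@q₀) for `U₀` — exactly the output shape of dag-n12-w3's (σ)_N producer at the
record (`N12GaugeLetterLocOfClass.exists_gaugeLetterLoc_atRecord_of_class`).  Proof: §2 at the minimiser `U₀^σ` of the SAME data (`B15Prop1MinimiserTowerAxialGauge.isMinimizer_gaugeAct_of_residual`:
the class is gauge invariant, the constrained averages are fixed by a residual gauge) with (T1@q₀) transported by §1.
[cite: Balaban1989LargeFieldII, p.357, (1.12)–(1.13) p.359; Balaban1989LargeFieldI, (1.74) p.192, Prop. 1 p.194; Balaban1985Variational, Thm 1 p.279, (3)–(4) p.278, (181) p.307; Balaban1988Convergent, (2.10)–(2.13) pp.256–257] -/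
theorem hMin_atRecord_of_node00Letters_thm1AtBase_central_ofClass_threshold_residual (ν : Node00.Stage7Numerics) (Kt : ℕ) (hd : 2 ≤ (F.P Kt).d) (Z : Set (Site (F.P Kt) 0))
    (Λ : Set (Site (F.P Kt) k)) (lo hi : Fin (F.P Kt).d → ℤ) (𝔹 : DetSet (F.P Kt)) (h𝔹Z : 𝔹 = Bj ν.M₁ Z k) (hkK : k + 1 ≤ (F.P Kt).m + (F.P Kt).K)
    (hM4 : 4 * (F.P Kt).L ≤ ν.M₁) (hdiv : side (F.P Kt).L ν.M₁ k ∣ (F.P Kt).sitesPerDir 0) (hZblk : B14.Eq22Determines.IsBlockUnion k Z) (hε : 0 ≤ ν.εreg)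
    {ρ'' : ℝ} (hsbU : ∀ W : GaugeField (F.P Kt) 0 SU2, ‖coeField W - 1‖ ≤ ρ'' → SmallBelow (Node00.avOfRecord F 2 Kt) k W)
    (hρ : 0 < ρ'') (hερ : 12 * ((((F.P Kt).d - 1 : ℕ)) : ℝ) * (F.P Kt).L * ν.εreg ≤ ρ'') {δ : ℝ} (hδ : 0 < δ) (hδρ : 6 * ((((F.P Kt).d - 1 : ℕ)) : ℝ) * (F.P Kt).L ^ k * δ ≤ ρ'')
    (ext : GaugeField (F.P Kt) k SU2 → GaugeField (F.P Kt) k SU2) (hext : ∀ W, ext W = extend Λ (shellGauge W lo hi) W)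
    {K : Set (GaugeField (F.P Kt) k SU2)} (hK : IsCompact K) {𝓐₀ : ℝ} (h𝓐₀ : 1 < 𝓐₀)
    (reg' : Set (GaugeField (F.P Kt) 0 SU2)) (hreg' : IsClosed reg') (hcl : closure (Node00.regMSCoPOfRecord F 2 ν Kt k (maxDomT ν.M₁ Z)) ⊆ reg')
    (hDreg' : ContinuousOn (fun (U : GaugeField (F.P Kt) 0 SU2) (i : Fin (constrCard 𝔹 k)) =>
      ((avgFamily (Node00.avOfRecord F 2 Kt) U ((constrEnum 𝔹 k).symm i).1 ((constrEnum 𝔹 k).symm i).2.1 : SU2) : Matrix (Fin 2) (Fin 2) ℂ)) reg')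
    (hk0 : 0 < k)
    -- ONCE per height: the right-inverse letter of the real chart (dag-n12-w6's `hHB`, inhabited by `N12HsurjOfClass.exists_hsurjLetters`)
    {εH B : ℝ}
    (hHB : ∀ (Wd : MSField (F.P Kt) SU2) (U₀ : GaugeField (F.P Kt) 0 SU2),
      AgreeOn (Bj ν.M₁ Z k) (avgFamily (avOfRecord F 2 Kt) U₀) Wd →
      (∀ i' : Fin (constrCard (Bj ν.M₁ Z k) k), ∃ U' : GaugeField (F.P Kt) 0 SU2,
        (∀ b ∈ feeds (((constrEnum (Bj ν.M₁ Z k) k).symm i').1 : ℕ) ((constrEnum (Bj ν.M₁ Z k) k).symm i').2.1, U' b = U₀ b) ∧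
          SmallBelow (avOfRecord F 2 Kt) k U') →
      (∀ (j : ℕ), 1 ≤ j → j ≤ k → ∀ y : Site (F.P Kt) j, embIter j y ∈ maxDomT ν.M₁ Z j → ∃ U' : GaugeField (F.P Kt) 0 SU2,
        (∀ c : PBond (F.P Kt) j, (c.src = y ∨ c.tgt = y) → ∀ b₀ : PBond (F.P Kt) 0,
          (iterBlockOf j b₀.src = c.src ∨ iterBlockOf j b₀.src = c.tgt) → (iterBlockOf j b₀.tgt = c.src ∨ iterBlockOf j b₀.tgt = c.tgt) → U' b₀ = U₀ b₀) ∧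
        SmallBelow (avOfRecord F 2 Kt) k U') →
      (∀ (j : ℕ), 1 ≤ j → j ≤ k → ∀ y : Site (F.P Kt) j, embIter j y ∈ maxDomT ν.M₁ Z j →
        PlaqSmallOn (boxPlaqs (fun κ => lift (F.P Kt) (embIter j y) κ - ((((F.P Kt).L ^ j : ℕ) : ℤ) + ((((F.P Kt).L ^ j - 1) / 2 : ℕ) : ℤ)))
          (fun κ => lift (F.P Kt) (embIter j y) κ + ((((F.P Kt).L ^ j : ℕ) : ℤ) + ((((F.P Kt).L ^ j - 1) / 2 : ℕ) : ℤ))) : Set (Plaq (F.P Kt) 0)) εH U₀) →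
      ∃ H : (Fin (constrCard (Bj ν.M₁ Z k) k) → lieSU (Fin 2)) → PBond (F.P Kt) 0 → lieSU (Fin 2),
        (∀ v, fderiv ℝ (msChart F 2 Kt k (Bj ν.M₁ Z k) Wd U₀) 0 (H v) = v) ∧ ∀ v, Real.sqrt (∑ b, ‖H v b‖ ^ 2) ≤ B * ‖v‖)
    (hεH : ν.εreg ≤ εH) (hB0 : 0 ≤ B)
    -- ONE forest and its axial slice per instance (dag-n12-w3's `N12ForestSlice.exists_forest_slice_Bj`): (F1), (F2), (TREE), (F3)
    (path : Site (F.P Kt) 0 → List (LStep (F.P Kt) 0)) (S : Submodule ℂ (VecField (F.P Kt) 0 (EuclideanSpace ℂ (Fin 3))))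
    (hF1 : ∀ x, ∀ s ∈ path x, ∃ x' x'' : Site (F.P Kt) 0, path x'' = path x' ++ [s] ∧
        (s.fwd = true → s.bond.src = x' ∧ s.bond.tgt = x'') ∧ (s.fwd = false → s.bond.src = x'' ∧ s.bond.tgt = x'))
    (hF2 : ∀ j, j ≤ k → ∀ c ∈ bondsOf (𝔹 j), path (embIter j c.src) = [] ∧ path (embIter j c.tgt) = [])
    (hTREE : ∀ x : Site (F.P Kt) 0, x ∉ {z : Site (F.P Kt) 0 | ∃ j, j ≤ k ∧ ∃ c ∈ bondsOf (𝔹 j), (z = embIter j c.src ∨ z = embIter j c.tgt)} →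
      ∃ (x' : Site (F.P Kt) 0) (s : LStep (F.P Kt) 0), path x = path x' ++ [s] ∧
        (s.fwd = true → s.bond.src = x' ∧ s.bond.tgt = x) ∧ (s.fwd = false → s.bond.src = x ∧ s.bond.tgt = x'))
    (hF3 : ∀ X : VecField (F.P Kt) 0 (EuclideanSpace ℂ (Fin 3)), X ∈ S ↔ ∀ x, ∀ s ∈ path x, X s.bond = 0) :
    -- THE GAUGE-TOLERANCE THRESHOLD, announced before the base fields (it absorbs the flat coercivity `c♭` of (P♭Q), the (L) constant and radius, the preimage letter `B₁` and the chart curvature `M₂`)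
    ∃ δ₀ : ℝ, 0 < δ₀ ∧
    ∀ {δc : ℝ}, 0 ≤ δc → δc ≤ δ₀ →
    (∀ Vk ∈ K, ∃ (U₀ : GaugeField (F.P Kt) 0 SU2) (σ : GaugeTransf (F.P Kt) 0 SU2),
      IsMinimizer (Node00.avOfRecord F 2 Kt) (Node00.regMSCoPOfRecord F 2 ν Kt k (maxDomT ν.M₁ Z)) 𝔹
        (avgFamily (Node00.avOfRecord F 2 Kt) (qsstarGIter0 k (ext Vk))) U₀ ∧
      PlaqSmallOn (plaqsInside (pts k Z)) δ (ext Vk) ∧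
      -- a RESIDUAL gauge `σ` (scale-`j` images `1` at both ends of every constrained bond — dag-n12-w3's (σ)_N producer's shape) …
      (∀ j, j ≤ k → ∀ b ∈ bondsOf (𝔹 j), toMS σ j b.src = 1 ∧ toMS σ j b.tgt = 1) ∧
      -- … in which (δ) holds: `U₀^σ` bondwise `δc`-flat on the plaquettes meeting a bond sourced in `Ω₁(Z)`; the tower-flatness row (δ_T) and the multiplier row (M) of p717767 FOLLOW (`B15Prop1TowerFlatOfNearFlat`; dag-n12-w6's `…N12MultiplierLetterOfClass` + the lane's `…N12SliceDatumCurvatureOfClass`)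
      (∀ q : Plaq (F.P Kt) 0, ((⟨q.src, q.μ⟩ : PBond (F.P Kt) 0) ∈ {b : PBond (F.P Kt) 0 | b.src ∈ maxDomT ν.M₁ Z 1} ∨
          (⟨q.src.shift q.μ, q.ν⟩ : PBond (F.P Kt) 0) ∈ {b : PBond (F.P Kt) 0 | b.src ∈ maxDomT ν.M₁ Z 1} ∨
          (⟨q.src.shift q.ν, q.μ⟩ : PBond (F.P Kt) 0) ∈ {b : PBond (F.P Kt) 0 | b.src ∈ maxDomT ν.M₁ Z 1} ∨
          (⟨q.src, q.ν⟩ : PBond (F.P Kt) 0) ∈ {b : PBond (F.P Kt) 0 | b.src ∈ maxDomT ν.M₁ Z 1}) →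
        ‖((gaugeAct σ U₀ ⟨q.src, q.μ⟩ : SU2) : Matrix (Fin 2) (Fin 2) ℂ) - 1‖ ≤ δc ∧ ‖((gaugeAct σ U₀ ⟨q.src.shift q.μ, q.ν⟩ : SU2) : Matrix (Fin 2) (Fin 2) ℂ) - 1‖ ≤ δc ∧
          ‖((gaugeAct σ U₀ ⟨q.src.shift q.ν, q.μ⟩ : SU2) : Matrix (Fin 2) (Fin 2) ℂ) - 1‖ ≤ δc ∧ ‖((gaugeAct σ U₀ ⟨q.src, q.ν⟩ : SU2) : Matrix (Fin 2) (Fin 2) ℂ) - 1‖ ≤ δc) ∧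
      -- (T1@q₀) — the capstone's row verbatim
      (∀ U ∈ reg', AgreeOn 𝔹 (avgFamily (Node00.avOfRecord F 2 Kt) U) (avgFamily (Node00.avOfRecord F 2 Kt) (qsstarGIter0 k (ext Vk))) →
        wilsonAction4 U ≤ wilsonAction4 U₀ →
          ∃ u : GaugeTransf (F.P Kt) 0 SU2, (∀ j, j ≤ k → ∀ b ∈ bondsOf (𝔹 j), toMS u j b.src = toMS u j b.tgt ∧ ∀ g : SU2, toMS u j b.src * g = g * toMS u j b.src) ∧ gaugeAct u U = U₀)) →
    ∃ R : ℝ, 0 < R ∧ ∀ Vk ∈ K,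
      ∃ Ũ : VecField (F.P Kt) k (EuclideanSpace ℂ (Fin 3)) × VecField (F.P Kt) k (EuclideanSpace ℂ (Fin 3)) → PBond (F.P Kt) 0 → Matrix (Fin 2) (Fin 2) ℂ,
        (∀ b i j, DifferentiableOn ℂ (fun z => Ũ z b i j) (ball 0 R)) ∧
        (∀ z ∈ ball (0 : VecField (F.P Kt) k (EuclideanSpace ℂ (Fin 3)) × VecField (F.P Kt) k (EuclideanSpace ℂ (Fin 3))) R, ∀ b i j, ‖Ũ z b i j‖ ≤ 𝓐₀) ∧
        ∀ p B' : VecField (F.P Kt) k E3, ‖p‖ < R → ‖B'‖ < R → ∃ U' : GaugeField (F.P Kt) 0 SU2,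
          (∀ b, Ũ (cplxVec p, cplxVec B') b = ((U' b : SU2) : Matrix (Fin 2) (Fin 2) ℂ)) ∧
            IsMinimizer (Node00.avOfRecord F 2 Kt) (Node00.regMSCoPOfRecord F 2 ν Kt k (maxDomT ν.M₁ Z)) 𝔹
              (avgFamily (Node00.avOfRecord F 2 Kt) (qsstarGIter0 k (expMul su2Chart B' (ext (expMul su2Chart p Vk))))) U' := by
  obtain ⟨δ₀, hδ₀, h⟩ := hMin_atRecord_of_node00Letters_thm1AtBase_central_ofClass_threshold ν Kt hd Z Λ lo hi 𝔹 h𝔹Z hkK hM4 hdiv hZblk hε hsbU hρ hερ hδ hδρ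
    ext hext hK h𝓐₀ reg' hreg' hcl hDreg' hk0 hHB hεH hB0 path S hF1 hF2 hTREE hF3
  refine ⟨δ₀, hδ₀, fun {δc} hδc0 hδcδ hbase => h hδc0 hδcδ fun Vk hVk => ?_⟩
  obtain ⟨U₀, σ, hmin, hreg, hσ, hNF, hT1⟩ := hbase Vk hVk
  subst h𝔹Z
  have hk : k ≤ (F.P Kt).m + (F.P Kt).K := Nat.le_of_succ_le hkK
  exact ⟨gaugeAct σ U₀,
    isMinimizer_gaugeAct_of_residual (Node00.avOfRecord F 2 Kt) (Bj ν.M₁ Z k) hk (fun _ hj => Bj_of_gt hj) hσ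
      (fun U hU => gaugeAct_mem_regMSCoPOfRecord ν Kt k (maxDomT ν.M₁ Z) σ U hU) hmin,
    hreg, hNF, thm1Row_gaugeAct_of_residual (Node00.avOfRecord F 2 Kt) reg' (Bj ν.M₁ Z k) k _ hσ hT1⟩

end Summit.QuantumFields.YangMills.BalabanUVNodes.N12MinimiserFamilyOfClassThreshold

end
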